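import Literature.NumberTheory.LFunctions.SelbergMollifierArith
import Literature.NumberTheory.LFunctions.MontgomeryVaughan2001PrimeSums
import Literature.NumberTheory.LFunctions.RieszMeanPerron
import HarnessLib

/-!
# Titchmarsh's Lemma 10.12: the mollifier sums `∑_{κ<Y,(κ,ρ)=1} α_κ κ^{θ-1} log(Y/κ)`

Second support file for the proof of A. Selberg's positive-proportion theorem in the arrangement
of E. C. Titchmarsh, *The Theory of the Riemann Zeta-Function*, 2nd ed. (1986), §10.9–§10.22.
Everything here is PROVED; no named facts.

**Lemma 10.12** (Titchmarsh p. 261): uniformly in `0 ≤ θ` (Titchmarsh: `0 ≤ θ ≤ ½`),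
`∑_{κ ≤ Y, (κ,ρ)=1} α_κ κ^{θ-1} log(Y/κ) = O(Y^θ log^{1/2} Y ∏_{p∣ρ}(1 + 1/p)^{1/2})`.
We prove it (`abs_mollLog_le`) in the form: there is an absolute `C` with
`|mollLog θ Y ρ| ≤ C Y^θ (1 + log Y)^{1/2} (∏_{p∣ρ}(1 + 1/p))^{1/2}` for all `ρ ≥ 1`, `θ ≥ 0`,
`Y ≥ 1`.

## The argument (a contour-free variant of Titchmarsh's)

Titchmarsh writes the sum as `(1/2πi)∫_{(1)} (Y^s/s²) ∏_{p∣ρ}(1-p^{-(1-θ+s)})^{-1/2} ζ(1-θ+s)^{-1/2} ds`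
and moves the contour to `re s = θ`, through the branch point of `ζ^{-1/2}` at `s = θ`, using
`|1/ζ(1+it)| < A|t|`. We instead integrate on the line `re s = c := θ + 1/log Y`, which lies
inside the half-plane of absolute convergence, so that no analytic continuation of `ζ^{-1/2}`
is needed:

1. (`hasMellin_logKer`, `mellinInv_logKer`) the Perron kernel of the logarithmic Riesz mean:
   `(1/2π)∫ x^{-(c+it)} (c+it)^{-2} dt = log⁺(1/x)` for `c > 0`, `x > 0` (Mellin inversion,
   Mathlib's `mellinInv_mellin_eq`, applied to `log⁺(1/x)` whose Mellin transform `1/s²` is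
   obtained from `mellin 𝟙_{(0,1]} = 1/s` by `mellin_hasDerivAt_of_isBigO_rpow`);
2. (`mollLog_eq_integral`) hence `mollLog θ Y ρ = (1/2π)∫ Y^{c+it}(c+it)^{-2} D(1+η+it) dt` with
   `η = 1/log Y` and `D(w) = ∑_{(κ,ρ)=1} α_κ κ^{-w}` (absolutely convergent interchange);
3. (`SelbergMollifierArith.norm_LSeries_alphaCop_sq_le`) `|D(w)|² ≤ |ζ(w)⁻¹| ∏_{p∣ρ}(1-p^{-re w})⁻¹`
   and `∏_{p∣ρ}(1-1/p)⁻¹ ≤ 2∏_{p∣ρ}(1+1/p)` (`prod_one_sub_inv_le`);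
4. (`norm_inv_zeta_le_far`, `exists_norm_inv_zeta_le_near`) `|ζ(1+η+it)⁻¹| ≤ ζ(1+η) ≤ 3/η`, and
   `|ζ(w)⁻¹| ≤ C_K |w-1|` on `1 < re w ≤ 3, |im w| ≤ 1` (compactness and `ζ(1+it) ≠ 0`, via
   Mathlib's entire `riemannZeta₁`);
5. so `∫ |Y^s s^{-2} D| ≤ e Y^θ (2P)^{1/2} ∫ [C_K^{1/2}(η²+t²)^{1/4} 𝟙_{|t|≤1} + (3/η)^{1/2} 𝟙_{|t|≥1}] dt/((θ+η)²+t²)`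
   `≤ C' Y^θ P^{1/2} η^{-1/2}`, using `∫ (u²+t²)^{-3/4} dt = C₀ u^{-1/2}` (scaling) and
   `∫ dt/(1+t²) = π`.

## References

* [Titchmarsh1986] E. C. Titchmarsh, *The Theory of the Riemann Zeta-Function*, 2nd ed. revised by
  D. R. Heath-Brown, Oxford 1986, §10.12, Lemma 10.12.
-/

noncomputable section

open Complex Real Finset ArithmeticFunction MeasureTheory Set Filter Asymptotics
open scoped ArithmeticFunction.Moebius Topology

namespace Literature.NumberTheory.LFunctions.SelbergMollifier

/-! ## §1 The Perron kernel of the logarithmic Riesz mean: `1/s² ↔ log⁺(1/x)` -/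

/-- `logKer x = log⁺(1/x) = max(-log x, 0)`, as a complex number. [folklore] -/
def logKer (x : ℝ) : ℂ := ((max (-Real.log x) 0 : ℝ) : ℂ)

/-- On `(0, ∞)`, `logKer = -(log • 𝟙_{(0,1]})`. [folklore] -/
theorem logKer_eq_neg_smul {t : ℝ} (ht : 0 < t) :
    logKer t = -((Real.log t) • (Ioc (0 : ℝ) 1).indicator (fun _ ↦ (1 : ℂ)) t) := by
  by_cases h1 : t ≤ 1
  · rw [indicator_of_mem (show t ∈ Ioc (0 : ℝ) 1 from ⟨ht, h1⟩),
      logKer, max_eq_left (neg_nonneg.mpr (Real.log_nonpos ht.le h1)), Complex.real_smul, mul_one,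
      ofReal_neg]
  · rw [indicator_of_notMem (show t ∉ Ioc (0 : ℝ) 1 from fun h ↦ h1 h.2), smul_zero, neg_zero, logKer,
      max_eq_right (by linarith [Real.log_pos (lt_of_not_ge h1)]), ofReal_zero]

/-- `logKer` is continuous. [folklore] -/
theorem continuousAt_logKer {x : ℝ} (hx : 0 < x) : ContinuousAt logKer x := by
  unfold logKer
  refine Complex.continuous_ofReal.continuousAt.comp ?_
  exact ((Real.continuousAt_log hx.ne').neg.max continuousAt_const)

/-- **The Mellin transform of `log⁺(1/x)` is `1/s²`** (`re s > 0`). [folklore] -/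
theorem hasMellin_logKer {s : ℂ} (hs : 0 < s.re) : HasMellin logKer s (1 / s ^ 2) := by
  set f : ℝ → ℂ := (Ioc (0 : ℝ) 1).indicator (fun _ ↦ (1 : ℂ)) with hf
  -- local integrability
  have hfi : Integrable f := by
    rw [hf, integrable_indicator_iff measurableSet_Ioc]
    exact integrableOn_const (by simp)
  have hfc : LocallyIntegrableOn f (Ioi 0) := hfi.integrableOn.locallyIntegrableOn
  -- decay at `∞`: `f = 0` eventually
  have hf_top : f =O[atTop] fun x : ℝ ↦ x ^ (-(s.re + 1)) := by
    have hev : f =ᶠ[atTop] fun _ ↦ (0 : ℂ) := by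
      filter_upwards [eventually_gt_atTop 1] with x hx
      rw [hf, indicator_of_notMem (fun h ↦ absurd h.2 (not_le.mpr hx))]
    exact hev.trans_isBigO (isBigO_zero _ _)
  -- boundedness at `0`
  have hf_bot : f =O[𝓝[>] 0] fun x : ℝ ↦ x ^ (-(0 : ℝ)) := by
    refine IsBigO.of_bound 1 (Eventually.of_forall fun x ↦ ?_)
    rw [neg_zero, Real.rpow_zero, Real.norm_eq_abs, abs_one, mul_one, hf]
    by_cases hx : x ∈ Ioc (0 : ℝ) 1
    · rw [indicator_of_mem hx]; simp
    · rw [indicator_of_notMem hx]; simp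
  obtain ⟨hconv, hder⟩ := mellin_hasDerivAt_of_isBigO_rpow hfc hf_top (by linarith) hf_bot hs
  -- `mellin f = 1/z` near `s`, so the derivative is `-1/s²`
  have hs0 : s ≠ 0 := fun h ↦ by simp [h] at hs
  have hev : mellin f =ᶠ[𝓝 s] fun z ↦ z⁻¹ := by
    have hopen : IsOpen {z : ℂ | 0 < z.re} := isOpen_lt continuous_const Complex.continuous_re
    filter_upwards [hopen.mem_nhds hs] with z hz
    rw [(hasMellin_one_Ioc hz).2, one_div]
  have hder2 : HasDerivAt (mellin f) (-(s ^ 2)⁻¹) s :=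
    (hasDerivAt_inv hs0).congr_of_eventuallyEq hev
  have hval : mellin (fun t ↦ Real.log t • f t) s = -(s ^ 2)⁻¹ := hder.unique hder2
  -- transport to `logKer`
  have hcongr : EqOn (fun t : ℝ ↦ (t : ℂ) ^ (s - 1) • logKer t)
      (fun t : ℝ ↦ -((t : ℂ) ^ (s - 1) • (Real.log t • f t))) (Ioi 0) := by
    intro t ht
    simp only [logKer_eq_neg_smul (mem_Ioi.mp ht), smul_neg, hf]
  constructor
  · unfold MellinConvergent
    exact (hconv.neg.congr_fun hcongr.symm measurableSet_Ioi)
  · unfold mellin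
    rw [setIntegral_congr_fun measurableSet_Ioi hcongr, integral_neg]
    change -mellin (fun t ↦ Real.log t • f t) s = 1 / s ^ 2
    rw [hval, neg_neg, one_div]

/-- `‖(σ + it)²‖ = σ² + t²`. [folklore] -/
theorem norm_sq_ofReal_add_mul_I (σ t : ℝ) : ‖((σ : ℂ) + t * I) ^ 2‖ = σ ^ 2 + t ^ 2 := by
  rw [norm_pow, Complex.sq_norm, Complex.normSq_apply]
  simp; ring

/-- **The Perron kernel of the logarithmic Riesz mean.** For `σ > 0` and `x > 0`,
`(1/2π)∫ x^{-(σ+it)} (σ+it)^{-2} dt = log⁺(1/x)`, i.e. `(1/2πi)∫_{(σ)} x^{-s} s^{-2} ds = max(-log x, 0)`.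
[folklore] -/
theorem mellinInv_logKer {σ : ℝ} (hσ : 0 < σ) {x : ℝ} (hx : 0 < x) :
    mellinInv σ (fun s ↦ 1 / s ^ 2) x = logKer x := by
  have hmel : ∀ t : ℝ, mellin logKer (σ + t * I) = 1 / ((σ : ℂ) + t * I) ^ 2 := fun t ↦
    (hasMellin_logKer (s := σ + t * I) (by simpa using hσ)).2
  have hconv : MellinConvergent logKer σ := (hasMellin_logKer (s := σ) (by simpa using hσ)).1
  have hvert : VerticalIntegrable (mellin logKer) σ := by
    unfold VerticalIntegrable
    have hint : Integrable fun t : ℝ ↦ 1 / ((σ : ℂ) + t * I) ^ 2 := by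
      refine (integrable_inv_sq_add_sq hσ).mono' ?_ (Eventually.of_forall fun t ↦ ?_)
      · exact (Continuous.div continuous_const (by fun_prop) fun t h ↦ by
          have := norm_sq_ofReal_add_mul_I σ t
          rw [h, norm_zero] at this
          nlinarith [sq_nonneg t]).aestronglyMeasurable
      · rw [norm_div, norm_one, norm_sq_ofReal_add_mul_I]
    exact hint.congr (Eventually.of_forall fun t ↦ (hmel t).symm)
  have hinv := mellinInv_mellin_eq σ logKer hx hconv hvert (continuousAt_logKer hx)
  rw [← hinv]
  unfold mellinInv
  congr 1
  refine integral_congr_ae (Eventually.of_forall fun t ↦ ?_)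
  simp only [hmel t]

/-! ## §2 Bounds for `ζ(w)⁻¹` slightly to the right of `re w = 1` -/

/-- `L(μ, w) = ζ(w)⁻¹` for `re w > 1`. [folklore] -/
theorem LSeries_moebius_eq_inv_zeta {w : ℂ} (hw : 1 < w.re) :
    LSeries (fun n ↦ ((μ n : ℤ) : ℂ)) w = (riemannZeta w)⁻¹ := by
  have h := LSeries_one_mul_Lseries_moebius hw
  rw [LSeries_one_eq_riemannZeta hw] at h
  exact (inv_eq_of_mul_eq_one_right h).symm

/-- `‖ζ(σ' + it)⁻¹‖ ≤ ‖ζ(σ')‖` for real `σ' > 1`: `|∑ μ(n) n^{-w}| ≤ ∑ n^{-σ'} = ζ(σ')`. [folklore] -/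
theorem norm_inv_zeta_le_zeta_real {σ' : ℝ} (hσ : 1 < σ') (t : ℝ) :
    ‖(riemannZeta (σ' + t * I))⁻¹‖ ≤ ‖riemannZeta (σ' : ℂ)‖ := by
  set w : ℂ := σ' + t * I with hw
  have hwre : w.re = σ' := by simp [hw]
  have hw1 : 1 < w.re := by rw [hwre]; exact hσ
  have hσre : 1 < (σ' : ℂ).re := by simpa using hσ
  rw [← LSeries_moebius_eq_inv_zeta hw1, ← LSeries_one_eq_riemannZeta hσre, LSeries, LSeries]
  have hs1 : Summable fun n ↦ ‖LSeries.term (fun n ↦ ((μ n : ℤ) : ℂ)) w n‖ :=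
    (LSeriesSummable_of_bounded_of_one_lt_re (fun n _ ↦ norm_moebius_cast_le_one n) hw1).norm
  have hs2 : LSeriesSummable 1 (σ' : ℂ) := LSeriesSummable_one_iff.mpr hσre
  -- the real series `∑ n^{-σ'}` is the value `ζ(σ')`
  have hreal : ∀ n : ℕ, (LSeries.term 1 (σ' : ℂ) n).re = ‖LSeries.term 1 (σ' : ℂ) n‖ := by
    intro n
    rcases eq_or_ne n 0 with rfl | hn
    · simp
    · have hr : LSeries.term 1 (σ' : ℂ) n = (((1 / (n : ℝ) ^ σ' : ℝ)) : ℂ) := by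
        rw [LSeries.term_of_ne_zero hn, Pi.one_apply, ofReal_div, ofReal_one,
          Complex.ofReal_cpow (by positivity), ofReal_natCast]
      rw [hr, ofReal_re, Complex.norm_real, Real.norm_eq_abs, abs_of_nonneg (by positivity)]
  have hre : (∑' n, LSeries.term 1 (σ' : ℂ) n).re = ∑' n, ‖LSeries.term 1 (σ' : ℂ) n‖ := by
    rw [Complex.re_tsum hs2]
    exact tsum_congr hreal
  calc ‖∑' n, LSeries.term (fun n ↦ ((μ n : ℤ) : ℂ)) w n‖
      ≤ ∑' n, ‖LSeries.term (fun n ↦ ((μ n : ℤ) : ℂ)) w n‖ := norm_tsum_le_tsum_norm hs1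
    _ ≤ ∑' n, ‖LSeries.term 1 (σ' : ℂ) n‖ := by
        refine hs1.tsum_le_tsum (fun n ↦ ?_) hs2.norm
        rcases eq_or_ne n 0 with rfl | hn
        · simp
        · rw [LSeries.term_of_ne_zero hn, LSeries.term_of_ne_zero hn, norm_div, norm_div, Pi.one_apply,
            norm_one, Complex.norm_natCast_cpow_of_pos (Nat.pos_of_ne_zero hn),
            Complex.norm_natCast_cpow_of_pos (Nat.pos_of_ne_zero hn), hwre, ofReal_re]
          exact div_le_div_of_nonneg_right (norm_moebius_cast_le_one n) (by positivity)
    _ = (∑' n, LSeries.term 1 (σ' : ℂ) n).re := hre.symm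
    _ ≤ ‖∑' n, LSeries.term 1 (σ' : ℂ) n‖ := Complex.re_le_norm _

/-- **Far from the pole**: `‖ζ(1 + η + it)⁻¹‖ ≤ 3/η` for `0 < η ≤ 2`. [folklore] -/
theorem norm_inv_zeta_le_far {η : ℝ} (hη : 0 < η) (hη2 : η ≤ 2) (t : ℝ) :
    ‖(riemannZeta (1 + η + t * I))⁻¹‖ ≤ 3 / η := by
  have h1 := norm_inv_zeta_le_zeta_real (σ' := 1 + η) (by linarith) t
  push_cast at h1
  have h2 := MontgomeryVaughan2001.norm_zeta_real_le (σ := 1 + η) (by linarith)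
  push_cast at h2
  rw [show (1 : ℝ) + η - 1 = η by ring] at h2
  calc ‖(riemannZeta (1 + η + t * I))⁻¹‖ ≤ ‖riemannZeta (1 + η)‖ := h1
    _ ≤ (1 + η) / η := h2
    _ ≤ 3 / η := div_le_div_of_nonneg_right (by linarith) hη.le

/-- The rectangle `K = {1 ≤ re w ≤ 3, |im w| ≤ 1}`. [folklore] -/
def nearOneRect : Set ℂ := (Icc (1 : ℝ) 3) ×ℂ (Icc (-1 : ℝ) 1)

/-- `K` is compact. [folklore] -/
theorem isCompact_nearOneRect : IsCompact nearOneRect := isCompact_Icc.reProdIm isCompact_Icc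

/-- `riemannZeta₁ ≠ 0` on `K` (`ζ(w) ≠ 0` for `re w ≥ 1`, and `ζ₁(1) = 1`). [folklore] -/
theorem riemannZeta₁_ne_zero_of_mem {w : ℂ} (hw : w ∈ nearOneRect) : riemannZeta₁ w ≠ 0 := by
  rcases eq_or_ne w 1 with rfl | h1
  · rw [riemannZeta₁_one]; exact one_ne_zero
  · have hre : 1 ≤ w.re := (mem_reProdIm.mp hw).1.1
    have hz : riemannZeta w ≠ 0 := riemannZeta_ne_zero_of_one_le_re hre
    intro h0
    have := riemannZeta_eq_inv_sub_mul h1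
    rw [h0, mul_zero] at this
    exact hz this

/-- **Near the pole**: there is `C > 0` with `‖ζ(w)⁻¹‖ ≤ C ‖w - 1‖` for `1 ≤ re w ≤ 3`, `|im w| ≤ 1`,
`w ≠ 1`. [folklore] -/
theorem exists_norm_inv_zeta_le_near :
    ∃ C : ℝ, 0 < C ∧ ∀ w : ℂ, w ∈ nearOneRect → w ≠ 1 → ‖(riemannZeta w)⁻¹‖ ≤ C * ‖w - 1‖ := by
  have hne : nearOneRect.Nonempty := ⟨1, by simp [nearOneRect, mem_reProdIm]⟩
  have hcont : ContinuousOn (fun w ↦ ‖riemannZeta₁ w‖) nearOneRect :=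
    (differentiable_riemannZeta₁.continuous.norm).continuousOn
  obtain ⟨w₀, hw₀, hmin⟩ := isCompact_nearOneRect.exists_isMinOn hne hcont
  set m : ℝ := ‖riemannZeta₁ w₀‖ with hm
  have hm0 : 0 < m := norm_pos_iff.mpr (riemannZeta₁_ne_zero_of_mem hw₀)
  refine ⟨m⁻¹, inv_pos.mpr hm0, fun w hw h1 ↦ ?_⟩
  have hmle : m ≤ ‖riemannZeta₁ w‖ := hmin hw
  rw [riemannZeta_eq_inv_sub_mul h1, mul_inv, inv_inv, norm_mul, mul_comm]
  rw [norm_inv]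
  exact mul_le_mul_of_nonneg_right (inv_anti₀ hm0 hmle) (norm_nonneg _)

/-! ## §3 The Euler-factor bookkeeping `∏_{p∣ρ}(1-1/p)⁻¹ ≤ 2 ∏_{p∣ρ}(1+1/p)` -/

/-- `∏_{2 ≤ n ≤ N} n²/(n²-1) = 2N/(N+1)` (telescoping). [folklore] -/
theorem prod_Icc_sq_div (N : ℕ) (hN : 1 ≤ N) :
    ∏ n ∈ Finset.Icc 2 N, ((n : ℝ) ^ 2 / ((n : ℝ) ^ 2 - 1)) = 2 * (N : ℝ) / ((N : ℝ) + 1) := by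
  induction N with
  | zero => omega
  | succ N ih =>
    rcases Nat.lt_or_ge N 1 with h | h
    · interval_cases N; norm_num
    · rw [Finset.prod_Icc_succ_top (by omega), ih h]
      have hN0 : (N : ℝ) ≠ 0 := Nat.cast_ne_zero.mpr (by omega)
      have hN1 : (N : ℝ) + 1 ≠ 0 := by positivity
      have hN2 : (N : ℝ) + 2 ≠ 0 := by positivity
      push_cast
      have h3 : ((N : ℝ) + 1) ^ 2 - 1 = N * (N + 2) := by ring
      rw [h3]
      field_simp
      ring

/-- For a finite set `S` of primes, `∏_{p∈S} (1 - p⁻²)⁻¹ ≤ 2`. [folklore] -/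
theorem prod_one_sub_inv_sq_inv_le_two {S : Finset ℕ} (hS : ∀ p ∈ S, p.Prime) :
    ∏ p ∈ S, (1 - ((p : ℝ) ^ 2)⁻¹)⁻¹ ≤ 2 := by
  -- compare with the product over `Icc 2 N`
  set N := S.sup id ⊔ 2 with hN
  have hsub : S ⊆ Finset.Icc 2 N := fun p hp ↦ by
    rw [Finset.mem_Icc]
    exact ⟨(hS p hp).two_le, le_sup_of_le_left (Finset.le_sup (f := id) hp)⟩
  have hfac : ∀ n ∈ Finset.Icc 2 N, (1 - ((n : ℝ) ^ 2)⁻¹)⁻¹ = (n : ℝ) ^ 2 / ((n : ℝ) ^ 2 - 1) := by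
    intro n hn
    rw [Finset.mem_Icc] at hn
    have : (2 : ℝ) ≤ n := by exact_mod_cast hn.1
    have h4 : (4 : ℝ) ≤ (n : ℝ) ^ 2 := by nlinarith
    field_simp
  have hge : ∀ n ∈ Finset.Icc 2 N, 1 ≤ (1 - ((n : ℝ) ^ 2)⁻¹)⁻¹ := by
    intro n hn
    rw [Finset.mem_Icc] at hn
    have : (2 : ℝ) ≤ n := by exact_mod_cast hn.1
    have h4 : (4 : ℝ) ≤ (n : ℝ) ^ 2 := by nlinarith
    rw [one_le_inv_iff₀]
    constructor
    · rw [sub_pos, inv_lt_one_iff₀]; right; linarith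
    · rw [sub_le_self_iff]; positivity
  have hrest : 1 ≤ ∏ n ∈ Finset.Icc 2 N \ S, (1 - ((n : ℝ) ^ 2)⁻¹)⁻¹ := by
    calc (1 : ℝ) = ∏ _n ∈ Finset.Icc 2 N \ S, (1 : ℝ) := Finset.prod_const_one.symm
      _ ≤ _ := Finset.prod_le_prod (fun _ _ ↦ zero_le_one) fun n hn ↦ hge n (Finset.sdiff_subset hn)
  have hSnn : 0 ≤ ∏ p ∈ S, (1 - ((p : ℝ) ^ 2)⁻¹)⁻¹ :=
    Finset.prod_nonneg fun p hp ↦ zero_le_one.trans (hge p (hsub hp))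
  calc ∏ p ∈ S, (1 - ((p : ℝ) ^ 2)⁻¹)⁻¹ = 1 * ∏ p ∈ S, (1 - ((p : ℝ) ^ 2)⁻¹)⁻¹ := (one_mul _).symm
    _ ≤ (∏ n ∈ Finset.Icc 2 N \ S, (1 - ((n : ℝ) ^ 2)⁻¹)⁻¹) * ∏ p ∈ S, (1 - ((p : ℝ) ^ 2)⁻¹)⁻¹ :=
        mul_le_mul_of_nonneg_right hrest hSnn
    _ = ∏ n ∈ Finset.Icc 2 N, (1 - ((n : ℝ) ^ 2)⁻¹)⁻¹ := Finset.prod_sdiff hsub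
    _ = ∏ n ∈ Finset.Icc 2 N, ((n : ℝ) ^ 2 / ((n : ℝ) ^ 2 - 1)) := Finset.prod_congr rfl hfac
    _ = 2 * (N : ℝ) / ((N : ℝ) + 1) := prod_Icc_sq_div N (by omega)
    _ ≤ 2 := by
        rw [div_le_iff₀ (by positivity)]; linarith [(N.cast_nonneg : (0 : ℝ) ≤ N)]

/-- **`∏_{p∣ρ}(1 - p^{-σ})⁻¹ ≤ 2 ∏_{p∣ρ}(1 + 1/p)`** for `σ ≥ 1`. [folklore] -/
theorem prod_one_sub_rpow_inv_le (ρ : ℕ) {σ : ℝ} (hσ : 1 ≤ σ) :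
    (∏ p ∈ ρ.primeFactors, (1 - (p : ℝ) ^ (-σ)))⁻¹ ≤ 2 * ∏ p ∈ ρ.primeFactors, (1 + (p : ℝ)⁻¹) := by
  have hp : ∀ p ∈ ρ.primeFactors, p.Prime := fun p hp ↦ Nat.prime_of_mem_primeFactors hp
  rw [← Finset.prod_inv_distrib]
  have h1 : ∏ p ∈ ρ.primeFactors, (1 - (p : ℝ) ^ (-σ))⁻¹ ≤ ∏ p ∈ ρ.primeFactors, (1 - (p : ℝ)⁻¹)⁻¹ := by
    refine Finset.prod_le_prod (fun p hp' ↦ ?_) fun p hp' ↦ ?_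
    · have := hp p hp'
      rw [inv_nonneg, sub_nonneg]
      exact Real.rpow_le_one_of_one_le_of_nonpos (by exact_mod_cast this.one_lt.le) (by linarith)
    · have hpp := hp p hp'
      have hp2 : (2 : ℝ) ≤ p := by exact_mod_cast hpp.two_le
      have hlt : (p : ℝ) ^ (-σ) ≤ (p : ℝ)⁻¹ := by
        rw [← Real.rpow_neg_one]
        exact Real.rpow_le_rpow_of_exponent_le (by linarith) (by linarith)
      have hpos : 0 < 1 - (p : ℝ)⁻¹ := by
        rw [sub_pos, inv_lt_one_iff₀]; right; linarith
      exact inv_anti₀ hpos (by linarith)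
  have h2 : ∏ p ∈ ρ.primeFactors, (1 - (p : ℝ)⁻¹)⁻¹ =
      (∏ p ∈ ρ.primeFactors, (1 + (p : ℝ)⁻¹)) * ∏ p ∈ ρ.primeFactors, (1 - ((p : ℝ) ^ 2)⁻¹)⁻¹ := by
    rw [← Finset.prod_mul_distrib]
    refine Finset.prod_congr rfl fun p hp' ↦ ?_
    have hp2 : (2 : ℝ) ≤ p := by exact_mod_cast (hp p hp').two_le
    have hne : (1 : ℝ) + (p : ℝ)⁻¹ ≠ 0 := by positivity
    rw [show (1 : ℝ) - ((p : ℝ) ^ 2)⁻¹ = (1 - (p : ℝ)⁻¹) * (1 + (p : ℝ)⁻¹) by field_simp; ring, mul_inv,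
      mul_comm (1 - (p : ℝ)⁻¹)⁻¹, ← mul_assoc, mul_inv_cancel₀ hne, one_mul]
  have h3 := prod_one_sub_inv_sq_inv_le_two hp
  have h4 : 0 ≤ ∏ p ∈ ρ.primeFactors, (1 + (p : ℝ)⁻¹) := Finset.prod_nonneg fun p _ ↦ by positivity
  calc ∏ p ∈ ρ.primeFactors, (1 - (p : ℝ) ^ (-σ))⁻¹ ≤ ∏ p ∈ ρ.primeFactors, (1 - (p : ℝ)⁻¹)⁻¹ := h1
    _ = (∏ p ∈ ρ.primeFactors, (1 + (p : ℝ)⁻¹)) * ∏ p ∈ ρ.primeFactors, (1 - ((p : ℝ) ^ 2)⁻¹)⁻¹ := h2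
    _ ≤ (∏ p ∈ ρ.primeFactors, (1 + (p : ℝ)⁻¹)) * 2 := mul_le_mul_of_nonneg_left h3 h4
    _ = 2 * ∏ p ∈ ρ.primeFactors, (1 + (p : ℝ)⁻¹) := mul_comm _ _

/-- `1 ≤ ∏_{p∣ρ}(1 + 1/p)`. [folklore] -/
theorem one_le_prod_one_add_inv (ρ : ℕ) : 1 ≤ ∏ p ∈ ρ.primeFactors, (1 + (p : ℝ)⁻¹) := by
  calc (1 : ℝ) = ∏ _p ∈ ρ.primeFactors, (1 : ℝ) := Finset.prod_const_one.symm
    _ ≤ _ := Finset.prod_le_prod (fun _ _ ↦ zero_le_one) fun p _ ↦ by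
        simp only [le_add_iff_nonneg_right]; positivity

/-- **Pointwise bound for the Dirichlet series** `D(w) = ∑_{(κ,ρ)=1} α_κ κ^{-w}`:
`‖D(w)‖ ≤ (2 ∏_{p∣ρ}(1+1/p))^{1/2} ‖ζ(w)⁻¹‖^{1/2}` for `re w > 1`. [cite: Titchmarsh1986, §10.12] -/
theorem norm_LSeries_alphaCop_le {ρ : ℕ} (hρ : ρ ≠ 0) {w : ℂ} (hw : 1 < w.re) :
    ‖LSeries (fun n ↦ alphaCop ρ n) w‖ ≤
      Real.sqrt (2 * ∏ p ∈ ρ.primeFactors, (1 + (p : ℝ)⁻¹)) * Real.sqrt ‖(riemannZeta w)⁻¹‖ := by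
  have h := norm_LSeries_alphaCop_sq_le hρ hw
  have hP := prod_one_sub_rpow_inv_le ρ (σ := w.re) hw.le
  have h2 : ‖LSeries (fun n ↦ alphaCop ρ n) w‖ ^ 2 ≤
      (2 * ∏ p ∈ ρ.primeFactors, (1 + (p : ℝ)⁻¹)) * ‖(riemannZeta w)⁻¹‖ := by
    calc _ ≤ ‖(riemannZeta w)⁻¹‖ * (∏ p ∈ ρ.primeFactors, (1 - (p : ℝ) ^ (-w.re)))⁻¹ := h
      _ ≤ ‖(riemannZeta w)⁻¹‖ * (2 * ∏ p ∈ ρ.primeFactors, (1 + (p : ℝ)⁻¹)) :=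
          mul_le_mul_of_nonneg_left hP (norm_nonneg _)
      _ = _ := mul_comm _ _
  rw [← Real.sqrt_mul (by positivity), ← Real.sqrt_sq (norm_nonneg (LSeries _ w))]
  exact Real.sqrt_le_sqrt h2

/-! ## §4 Titchmarsh's sums `mollLog` and their Perron representation -/

/-- **The sums of Lemma 10.12**: `mollLog θ Y ρ = ∑_{1 ≤ κ < Y, (κ,ρ)=1} α_κ κ^{θ-1} log(Y/κ)`.
[cite: Titchmarsh1986, Lemma 10.12] -/
def mollLog (θ Y : ℝ) (ρ : ℕ) : ℝ :=
  ∑ κ ∈ mollRange Y, if κ.Coprime ρ then selbergAlpha κ * (κ : ℝ) ^ (θ - 1) * Real.log (Y / κ) else 0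

/-- The coefficients `a_κ = α_κ 1_{(κ,ρ)=1} κ^{θ-1}` (complex). [folklore] -/
def mollCoeff (θ : ℝ) (ρ κ : ℕ) : ℂ := alphaCop ρ κ * (((κ : ℝ) ^ (θ - 1) : ℝ) : ℂ)

/-- `a_0 = 0`. [folklore] -/
@[simp] theorem mollCoeff_zero (θ : ℝ) (ρ : ℕ) : mollCoeff θ ρ 0 = 0 := by
  simp [mollCoeff]

/-- `‖a_κ‖ ≤ κ^{θ-1}`. [folklore] -/
theorem norm_mollCoeff_le (θ : ℝ) (ρ κ : ℕ) : ‖mollCoeff θ ρ κ‖ ≤ (κ : ℝ) ^ (θ - 1) := by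
  rw [mollCoeff, norm_mul, Complex.norm_real, Real.norm_eq_abs, abs_of_nonneg (by positivity)]
  calc ‖alphaCop ρ κ‖ * (κ : ℝ) ^ (θ - 1) ≤ 1 * (κ : ℝ) ^ (θ - 1) :=
        mul_le_mul_of_nonneg_right (norm_alphaCop_le ρ κ) (by positivity)
    _ = _ := one_mul _

/-- The summand of `mollLog`, rewritten with `a_κ` and the kernel `log⁺(Y/κ)`. [folklore] -/
theorem mollLog_summand_eq {θ Y : ℝ} {ρ κ : ℕ} (hκ : κ ∈ mollRange Y) :
    (((if κ.Coprime ρ then selbergAlpha κ * (κ : ℝ) ^ (θ - 1) * Real.log (Y / κ) else 0 : ℝ)) : ℂ) =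
      mollCoeff θ ρ κ * logKer (κ / Y) := by
  obtain ⟨h1, hY⟩ := mem_mollRange.mp hκ
  have hκ0 : (0 : ℝ) < κ := by exact_mod_cast h1
  have hlog : logKer (κ / Y) = ((Real.log (Y / κ) : ℝ) : ℂ) := by
    rw [logKer]
    congr 1
    have : Real.log (κ / Y) = -Real.log (Y / κ) := by
      rw [← Real.log_inv, inv_div]
    rw [this, neg_neg, max_eq_left]
    exact Real.log_nonneg ((one_le_div hκ0).mpr hY.le)
  rw [hlog, mollCoeff, alphaCop, ArithmeticFunction.pmul_apply, alphaC_apply]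
  by_cases hc : κ.Coprime ρ
  · rw [if_pos hc, copInd_of_coprime (by omega) hc]
    push_cast; ring
  · rw [if_neg hc, copInd_of_not_coprime hc]
    push_cast; ring

/-- `mollLog` as a sum of `a_κ log⁺(Y/κ)`. [folklore] -/
theorem mollLog_eq_sum (θ Y : ℝ) (ρ : ℕ) :
    ((mollLog θ Y ρ : ℝ) : ℂ) = ∑ κ ∈ mollRange Y, mollCoeff θ ρ κ * logKer (κ / Y) := by
  rw [mollLog]
  push_cast
  exact Finset.sum_congr rfl fun κ hκ ↦ mollLog_summand_eq hκ

/-- Off `mollRange Y` the summand vanishes (`κ = 0`, or `κ ≥ Y` where `log⁺(Y/κ) = 0`). [folklore] -/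
theorem mollCoeff_mul_logKer_eq_zero {θ Y : ℝ} (hY : 0 < Y) {ρ κ : ℕ} (hκ : κ ∉ mollRange Y) :
    mollCoeff θ ρ κ * logKer (κ / Y) = 0 := by
  rcases eq_or_ne κ 0 with rfl | h0
  · simp
  · have hge : Y ≤ κ := by
      by_contra h
      exact hκ (mem_mollRange.mpr ⟨Nat.one_le_iff_ne_zero.mpr h0, lt_of_not_ge h⟩)
    have : logKer (κ / Y) = 0 := by
      rw [logKer, max_eq_right, ofReal_zero]
      rw [neg_nonpos]
      exact Real.log_nonneg ((one_le_div hY).mpr hge)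
    rw [this, mul_zero]

/-- `mollLog` as an infinite sum over all `κ`. [folklore] -/
theorem mollLog_eq_tsum {θ Y : ℝ} (hY : 0 < Y) (ρ : ℕ) :
    ((mollLog θ Y ρ : ℝ) : ℂ) = ∑' κ : ℕ, mollCoeff θ ρ κ * logKer (κ / Y) := by
  rw [mollLog_eq_sum, tsum_eq_sum]
  exact fun κ hκ ↦ mollCoeff_mul_logKer_eq_zero hY hκ

/-- `(a/Y)^{-s} = a^{-s} Y^{s}` for `a ≥ 0`, `Y > 0`. [folklore] -/
theorem ofReal_div_cpow_neg {a Y : ℝ} (ha : 0 ≤ a) (hY : 0 < Y) (s : ℂ) :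
    (((a / Y : ℝ)) : ℂ) ^ (-s) = (a : ℂ) ^ (-s) * (Y : ℂ) ^ s := by
  have harg : (Y : ℂ).arg ≠ π := by rw [arg_ofReal_of_nonneg hY.le]; exact Real.pi_pos.ne
  have h1 : ((Y : ℂ)⁻¹) ^ (-s) = (Y : ℂ) ^ s := by
    rw [inv_cpow _ _ harg, cpow_neg, inv_inv]
  rw [div_eq_mul_inv, ofReal_mul, mul_cpow_ofReal_nonneg ha (inv_nonneg.mpr hY.le), ofReal_inv, h1]

/-- The Perron integrand of the `κ`-th term on the line `re s = σ`. [folklore] -/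
def perronTerm (θ Y σ : ℝ) (ρ κ : ℕ) (y : ℝ) : ℂ :=
  (1 / (2 * π) : ℂ) * ((((κ : ℝ) / Y : ℝ)) : ℂ) ^ (-((σ : ℂ) + y * I)) *
    (1 / ((σ : ℂ) + y * I) ^ 2) * mollCoeff θ ρ κ

/-- `perronTerm` vanishes for `κ = 0`. [folklore] -/
@[simp] theorem perronTerm_zero (θ Y σ : ℝ) (ρ : ℕ) : perronTerm θ Y σ ρ 0 = fun _ ↦ 0 := by
  funext y; simp [perronTerm]

/-- Each term of `mollLog` is a Perron integral: `a_κ log⁺(Y/κ) = ∫ perronTerm`. [folklore] -/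
theorem mollCoeff_mul_logKer_eq_integral {θ Y σ : ℝ} (hY : 0 < Y) (hσ : 0 < σ) (ρ κ : ℕ) :
    mollCoeff θ ρ κ * logKer (κ / Y) = ∫ y : ℝ, perronTerm θ Y σ ρ κ y := by
  rcases eq_or_ne κ 0 with rfl | h0
  · simp
  have hx : 0 < (κ : ℝ) / Y := div_pos (by exact_mod_cast Nat.pos_of_ne_zero h0) hY
  rw [← mellinInv_logKer hσ hx, mellinInv, Complex.real_smul, mul_comm, mul_assoc,
    ← integral_mul_const, ← integral_const_mul]
  refine integral_congr_ae (Eventually.of_forall fun y ↦ ?_)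
  simp only [perronTerm, smul_eq_mul]
  push_cast
  ring

/-- `(σ + iy)² ≠ 0` for `σ > 0`. [folklore] -/
theorem sq_line_ne_zero {σ : ℝ} (hσ : 0 < σ) (y : ℝ) : ((σ : ℂ) + y * I) ^ 2 ≠ 0 := by
  intro h
  have := norm_sq_ofReal_add_mul_I σ y
  rw [h, norm_zero] at this
  nlinarith [sq_nonneg y]

/-- `perronTerm` is continuous in `y`. [folklore] -/
theorem continuous_perronTerm (θ : ℝ) {Y σ : ℝ} (hY : 0 < Y) (hσ : 0 < σ) (ρ κ : ℕ) :
    Continuous (perronTerm θ Y σ ρ κ) := by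
  rcases eq_or_ne κ 0 with rfl | h0
  · rw [perronTerm_zero]; exact continuous_const
  have hx : 0 < (κ : ℝ) / Y := div_pos (by exact_mod_cast Nat.pos_of_ne_zero h0) hY
  unfold perronTerm
  refine ((continuous_const.mul ?_).mul ?_).mul continuous_const
  · exact Continuous.const_cpow (by fun_prop) (Or.inl (ofReal_ne_zero.mpr hx.ne'))
  · exact Continuous.div continuous_const (by fun_prop) (sq_line_ne_zero hσ)

/-- The norm of the Perron integrand: `‖perronTerm‖ = (1/2π) (κ/Y)^{-σ} ‖a_κ‖ /(σ²+y²)`. [folklore] -/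
theorem norm_perronTerm {θ Y σ : ℝ} (hY : 0 < Y) {ρ κ : ℕ} (hκ : κ ≠ 0) (y : ℝ) :
    ‖perronTerm θ Y σ ρ κ y‖ =
      1 / (2 * π) * ((κ : ℝ) / Y) ^ (-σ) * ‖mollCoeff θ ρ κ‖ * (1 / (σ ^ 2 + y ^ 2)) := by
  have hx : 0 < (κ : ℝ) / Y := div_pos (by exact_mod_cast Nat.pos_of_ne_zero hκ) hY
  rw [perronTerm]
  simp only [norm_mul, norm_div, norm_one, norm_sq_ofReal_add_mul_I, Complex.norm_cpow_eq_rpow_re_of_pos hx,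
    Complex.norm_ofNat, Complex.norm_real, Real.norm_eq_abs, abs_of_pos Real.pi_pos, neg_re, add_re,
    ofReal_re, mul_re, I_re, mul_zero, ofReal_im, I_im, mul_one, sub_self, add_zero]
  ring

/-- `perronTerm` is integrable in `y`. [folklore] -/
theorem integrable_perronTerm (θ : ℝ) {Y σ : ℝ} (hY : 0 < Y) (hσ : 0 < σ) (ρ κ : ℕ) :
    Integrable (perronTerm θ Y σ ρ κ) := by
  rcases eq_or_ne κ 0 with rfl | h0
  · rw [perronTerm_zero]; exact integrable_zero _ _ _
  refine ((integrable_inv_sq_add_sq hσ).const_mul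
    (1 / (2 * π) * ((κ : ℝ) / Y) ^ (-σ) * ‖mollCoeff θ ρ κ‖)).mono'
    (continuous_perronTerm θ hY hσ ρ κ).aestronglyMeasurable (Eventually.of_forall fun y ↦ ?_)
  rw [norm_perronTerm hY h0]

/-- `∫ ‖perronTerm_κ‖ = (1/2π) (κ/Y)^{-σ} ‖a_κ‖ ∫ dy/(σ²+y²)`. [folklore] -/
theorem integral_norm_perronTerm {θ Y σ : ℝ} (hY : 0 < Y) (ρ κ : ℕ) :
    ∫ y : ℝ, ‖perronTerm θ Y σ ρ κ y‖ =
      1 / (2 * π) * ((κ : ℝ) / Y) ^ (-σ) * ‖mollCoeff θ ρ κ‖ * ∫ y : ℝ, 1 / (σ ^ 2 + y ^ 2) := by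
  rcases eq_or_ne κ 0 with rfl | h0
  · simp
  rw [← integral_const_mul]
  exact integral_congr_ae (Eventually.of_forall fun y ↦ norm_perronTerm hY h0 y)

/-- Summability of `κ ↦ ∫ ‖perronTerm_κ‖` for `σ > θ` (absolute convergence of the Dirichlet series
on `re = 1 - θ + σ > 1`). [folklore] -/
theorem summable_integral_norm_perronTerm (θ : ℝ) {Y σ : ℝ} (hY : 0 < Y) (hθσ : θ < σ) (ρ : ℕ) :
    Summable fun κ : ℕ ↦ ∫ y : ℝ, ‖perronTerm θ Y σ ρ κ y‖ := by
  set I₀ : ℝ := ∫ y : ℝ, 1 / (σ ^ 2 + y ^ 2) with hI₀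
  have hI₀0 : 0 ≤ I₀ := integral_nonneg fun y ↦ by positivity
  have hsum : Summable fun κ : ℕ ↦ 1 / (2 * π) * Y ^ σ * I₀ * (κ : ℝ) ^ (θ - 1 - σ) :=
    (Real.summable_nat_rpow.mpr (by linarith)).mul_left _
  refine Summable.of_nonneg_of_le (fun κ ↦ integral_nonneg fun y ↦ norm_nonneg _) (fun κ ↦ ?_) hsum
  rw [integral_norm_perronTerm hY]
  rcases eq_or_ne κ 0 with rfl | h0
  · simp
    positivity
  have hκ : (0 : ℝ) < κ := by exact_mod_cast Nat.pos_of_ne_zero h0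
  have h1 : ((κ : ℝ) / Y) ^ (-σ) = Y ^ σ * (κ : ℝ) ^ (-σ) := by
    rw [Real.div_rpow hκ.le hY.le, Real.rpow_neg hY.le, Real.rpow_neg hκ.le]
    field_simp
  have h2 : ‖mollCoeff θ ρ κ‖ ≤ (κ : ℝ) ^ (θ - 1) := norm_mollCoeff_le θ ρ κ
  have h3 : (κ : ℝ) ^ (-σ) * (κ : ℝ) ^ (θ - 1) = (κ : ℝ) ^ (θ - 1 - σ) := by
    rw [← Real.rpow_add hκ]; ring_nf
  calc 1 / (2 * π) * ((κ : ℝ) / Y) ^ (-σ) * ‖mollCoeff θ ρ κ‖ * I₀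
      ≤ 1 / (2 * π) * ((κ : ℝ) / Y) ^ (-σ) * (κ : ℝ) ^ (θ - 1) * I₀ := by gcongr
    _ = 1 / (2 * π) * Y ^ σ * I₀ * ((κ : ℝ) ^ (-σ) * (κ : ℝ) ^ (θ - 1)) := by rw [h1]; ring
    _ = 1 / (2 * π) * Y ^ σ * I₀ * (κ : ℝ) ^ (θ - 1 - σ) := by rw [h3]

/-- The Perron integrand after summation: `(1/2π) Y^s s^{-2} D(1-θ+s)`, `s = σ + iy`,
`D(w) = ∑_{(κ,ρ)=1} α_κ κ^{-w}`. [folklore] -/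
def mollLogIntegrand (θ Y σ : ℝ) (ρ : ℕ) (y : ℝ) : ℂ :=
  (1 / (2 * π) : ℂ) * (Y : ℂ) ^ ((σ : ℂ) + y * I) * (1 / ((σ : ℂ) + y * I) ^ 2) *
    LSeries (fun n ↦ alphaCop ρ n) (1 - θ + ((σ : ℂ) + y * I))

/-- `a_κ (κ/Y)^{-s} = Y^s · (α_κ 1_ρ(κ) κ^{-(1-θ+s)})`. [folklore] -/
theorem mollCoeff_mul_cpow {θ Y : ℝ} (hY : 0 < Y) (ρ κ : ℕ) (s : ℂ) :
    ((((κ : ℝ) / Y : ℝ)) : ℂ) ^ (-s) * mollCoeff θ ρ κ =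
      (Y : ℂ) ^ s * LSeries.term (fun n ↦ alphaCop ρ n) (1 - θ + s) κ := by
  rcases eq_or_ne κ 0 with rfl | h0
  · simp
  have hκ : (0 : ℝ) < κ := by exact_mod_cast Nat.pos_of_ne_zero h0
  have hκC : (κ : ℂ) ≠ 0 := Nat.cast_ne_zero.mpr h0
  rw [ofReal_div_cpow_neg hκ.le hY, LSeries.term_of_ne_zero h0, mollCoeff, ofReal_natCast,
    Complex.ofReal_cpow hκ.le, ofReal_natCast, div_eq_mul_inv, ← cpow_neg]
  have : (κ : ℂ) ^ (-s) * (κ : ℂ) ^ (((θ - 1 : ℝ)) : ℂ) = (κ : ℂ) ^ (-(1 - θ + s)) := by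
    rw [← cpow_add _ _ hκC]
    congr 1
    push_cast; ring
  calc (κ : ℂ) ^ (-s) * (Y : ℂ) ^ s * (alphaCop ρ κ * (κ : ℂ) ^ (((θ - 1 : ℝ)) : ℂ))
      = (Y : ℂ) ^ s * (alphaCop ρ κ * ((κ : ℂ) ^ (-s) * (κ : ℂ) ^ (((θ - 1 : ℝ)) : ℂ))) := by ring
    _ = _ := by rw [this]

/-- **Summing the Perron integrands**: `∑_κ perronTerm_κ(y) = (1/2π) Y^s s^{-2} D(1-θ+s)`.
[folklore] -/
theorem tsum_perronTerm {θ Y : ℝ} (hY : 0 < Y) (σ : ℝ) (ρ : ℕ) (y : ℝ) :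
    ∑' κ : ℕ, perronTerm θ Y σ ρ κ y = mollLogIntegrand θ Y σ ρ y := by
  have h : ∀ κ : ℕ, perronTerm θ Y σ ρ κ y =
      (1 / (2 * π) : ℂ) * (Y : ℂ) ^ ((σ : ℂ) + y * I) * (1 / ((σ : ℂ) + y * I) ^ 2) *
        LSeries.term (fun n ↦ alphaCop ρ n) (1 - θ + ((σ : ℂ) + y * I)) κ := by
    intro κ
    have hm := mollCoeff_mul_cpow (θ := θ) hY ρ κ ((σ : ℂ) + y * I)
    unfold perronTerm
    calc (1 / (2 * π) : ℂ) * ((((κ : ℝ) / Y : ℝ)) : ℂ) ^ (-((σ : ℂ) + y * I)) *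
          (1 / ((σ : ℂ) + y * I) ^ 2) * mollCoeff θ ρ κ
        = (1 / (2 * π) : ℂ) * (1 / ((σ : ℂ) + y * I) ^ 2) *
            (((((κ : ℝ) / Y : ℝ)) : ℂ) ^ (-((σ : ℂ) + y * I)) * mollCoeff θ ρ κ) := by ring
      _ = (1 / (2 * π) : ℂ) * (1 / ((σ : ℂ) + y * I) ^ 2) *
            ((Y : ℂ) ^ ((σ : ℂ) + y * I) * LSeries.term (fun n ↦ alphaCop ρ n) (1 - θ + ((σ : ℂ) + y * I)) κ) := by
          rw [hm]
      _ = _ := by ring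
  rw [tsum_congr h, tsum_mul_left, mollLogIntegrand, LSeries]

/-- **Perron representation of Titchmarsh's sum (no contour shift).** For `Y > 0` and
`σ > max(θ, 0)`, `mollLog θ Y ρ = (1/2π) ∫ Y^{σ+it} (σ+it)^{-2} D(1-θ+σ+it) dt`.
[cite: Titchmarsh1986, §10.12 (10.12.2)] -/
theorem mollLog_eq_integral {θ Y σ : ℝ} (hY : 0 < Y) (hσ : 0 < σ) (hθσ : θ < σ) (ρ : ℕ) :
    ((mollLog θ Y ρ : ℝ) : ℂ) = ∫ y : ℝ, mollLogIntegrand θ Y σ ρ y := by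
  rw [mollLog_eq_tsum hY]
  have h1 : ∀ κ : ℕ, mollCoeff θ ρ κ * logKer (κ / Y) = ∫ y : ℝ, perronTerm θ Y σ ρ κ y :=
    fun κ ↦ mollCoeff_mul_logKer_eq_integral hY hσ ρ κ
  rw [tsum_congr h1, integral_tsum_of_summable_integral_norm (integrable_perronTerm θ hY hσ ρ)
    (summable_integral_norm_perronTerm θ hY hθσ ρ)]
  exact integral_congr_ae (Eventually.of_forall fun y ↦ tsum_perronTerm hY σ ρ y)

/-! ## §5 Lemma 10.12 -/

/-- `Y^{1/log Y} = e`. [folklore] -/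
theorem rpow_inv_log {Y : ℝ} (hY : 1 < Y) : Y ^ (1 / Real.log Y) = Real.exp 1 := by
  have hlog : 0 < Real.log Y := Real.log_pos hY
  rw [Real.rpow_def_of_pos (by linarith), show Real.log Y * (1 / Real.log Y) = 1 by field_simp]

/-- The constant `C₀ = ∫ (1+v²)^{-3/4} dv`. [folklore] -/
def threeQuarterConst : ℝ := ∫ v : ℝ, (1 + v ^ 2) ^ (-(3 / 4 : ℝ))

/-- `(1+v²)^{-3/4}` is integrable on `ℝ`. [folklore] -/
theorem integrable_one_add_sq_rpow : Integrable fun v : ℝ ↦ (1 + v ^ 2) ^ (-(3 / 4 : ℝ)) := by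
  have h : Integrable fun x : ℝ ↦ (1 + ‖x‖ ^ 2) ^ (-(3 / 2 : ℝ) / 2) :=
    integrable_rpow_neg_one_add_norm_sq (by rw [Module.finrank_self]; norm_num)
  refine h.congr (Eventually.of_forall fun v ↦ ?_)
  simp only [Real.norm_eq_abs, sq_abs]
  norm_num

/-- `0 ≤ C₀`. [folklore] -/
theorem threeQuarterConst_nonneg : 0 ≤ threeQuarterConst :=
  integral_nonneg fun v ↦ by positivity

/-- **Scaling**: `∫ (σ²+y²)^{-3/4} dy = C₀ σ^{-1/2}` for `σ > 0`. [folklore] -/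
theorem integral_sq_add_sq_rpow {σ : ℝ} (hσ : 0 < σ) :
    ∫ y : ℝ, (σ ^ 2 + y ^ 2) ^ (-(3 / 4 : ℝ)) = threeQuarterConst * σ ^ (-(1 / 2 : ℝ)) := by
  have hpt : ∀ y : ℝ, (σ ^ 2 + y ^ 2) ^ (-(3 / 4 : ℝ)) =
      σ ^ (-(3 / 2 : ℝ)) * (1 + (y / σ) ^ 2) ^ (-(3 / 4 : ℝ)) := by
    intro y
    have h1 : σ ^ 2 + y ^ 2 = σ ^ 2 * (1 + (y / σ) ^ 2) := by field_simp
    rw [h1, Real.mul_rpow (by positivity) (by positivity)]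
    congr 1
    rw [show (σ ^ 2 : ℝ) = σ ^ (2 : ℝ) by norm_cast, ← Real.rpow_mul hσ.le]
    norm_num
  simp_rw [hpt]
  rw [integral_const_mul, Measure.integral_comp_div (fun v ↦ (1 + v ^ 2) ^ (-(3 / 4 : ℝ))) σ,
    abs_of_pos hσ, smul_eq_mul, threeQuarterConst]
  have : σ ^ (-(3 / 2 : ℝ)) * σ = σ ^ (-(1 / 2 : ℝ)) := by
    conv_lhs => rw [show σ ^ (-(3 / 2 : ℝ)) * σ = σ ^ (-(3 / 2 : ℝ)) * σ ^ (1 : ℝ) by rw [Real.rpow_one],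
      ← Real.rpow_add hσ]
    norm_num
  rw [← mul_assoc, this, mul_comm]

/-- `(σ²+y²)^{-3/4}`, rescaled, is integrable. [folklore] -/
theorem integrable_sq_add_sq_rpow {σ : ℝ} (hσ : 0 < σ) :
    Integrable fun y : ℝ ↦ (σ ^ 2 + y ^ 2) ^ (-(3 / 4 : ℝ)) := by
  have hpt : ∀ y : ℝ, (σ ^ 2 + y ^ 2) ^ (-(3 / 4 : ℝ)) =
      σ ^ (-(3 / 2 : ℝ)) * (1 + (y / σ) ^ 2) ^ (-(3 / 4 : ℝ)) := by
    intro y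
    have h1 : σ ^ 2 + y ^ 2 = σ ^ 2 * (1 + (y / σ) ^ 2) := by field_simp
    rw [h1, Real.mul_rpow (by positivity) (by positivity)]
    congr 1
    rw [show (σ ^ 2 : ℝ) = σ ^ (2 : ℝ) by norm_cast, ← Real.rpow_mul hσ.le]
    norm_num
  simp_rw [hpt]
  exact ((integrable_one_add_sq_rpow.comp_div hσ.ne').const_mul _)

/-- `√(√x) = x^{1/4}` for `x ≥ 0`. [folklore] -/
theorem sqrt_sqrt_eq_rpow_quarter {x : ℝ} (hx : 0 ≤ x) : Real.sqrt (Real.sqrt x) = x ^ (1 / 4 : ℝ) := by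
  rw [Real.sqrt_eq_rpow, Real.sqrt_eq_rpow, ← Real.rpow_mul hx]
  norm_num

/-- `log 2 > 1/2`, so `1/log Y ≤ 2` for `Y ≥ 2`. [folklore] -/
theorem inv_log_le_two {Y : ℝ} (hY : 2 ≤ Y) : 1 / Real.log Y ≤ 2 := by
  have h2 : (1 / 2 : ℝ) < Real.log 2 := by
    have := Real.log_two_gt_d9; linarith
  have hlog : Real.log 2 ≤ Real.log Y := Real.log_le_log (by norm_num) hY
  rw [div_le_iff₀ (by linarith)]; linarith

/-- **Titchmarsh's Lemma 10.12**, range `Y ≥ 2`: there is an absolute `C` with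
`|∑_{κ<Y,(κ,ρ)=1} α_κ κ^{θ-1} log(Y/κ)| ≤ C Y^θ (log Y)^{1/2} (∏_{p∣ρ}(1+1/p))^{1/2}` for all `ρ ≥ 1`,
`θ ≥ 0`, `Y ≥ 2`. [cite: Titchmarsh1986, Lemma 10.12] -/
theorem abs_mollLog_le_of_two_le :
    ∃ C : ℝ, 0 < C ∧ ∀ ρ : ℕ, ρ ≠ 0 → ∀ θ : ℝ, 0 ≤ θ → ∀ Y : ℝ, 2 ≤ Y →
      |mollLog θ Y ρ| ≤ C * Y ^ θ * Real.sqrt (Real.log Y) *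
        Real.sqrt (∏ p ∈ ρ.primeFactors, (1 + (p : ℝ)⁻¹)) := by
  obtain ⟨CK, hCK, hnear⟩ := exists_norm_inv_zeta_le_near
  set C₀ := threeQuarterConst with hC₀
  refine ⟨Real.exp 1 / (2 * π) * Real.sqrt 2 * (Real.sqrt CK * C₀ + 2 * π * Real.sqrt 3), ?_,
    fun ρ hρ θ hθ Y hY ↦ ?_⟩
  · have : 0 < Real.sqrt CK * C₀ + 2 * π * Real.sqrt 3 := by
      have h1 : 0 ≤ Real.sqrt CK * C₀ := mul_nonneg (Real.sqrt_nonneg _) threeQuarterConst_nonneg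
      positivity
    positivity
  -- parameters
  have hY0 : 0 < Y := by linarith
  have hY1 : 1 < Y := by linarith
  have hlog : 0 < Real.log Y := Real.log_pos hY1
  set η : ℝ := 1 / Real.log Y with hη
  have hη0 : 0 < η := by positivity
  have hη2 : η ≤ 2 := inv_log_le_two hY
  set σ : ℝ := θ + η with hσ
  have hσ0 : 0 < σ := by linarith
  have hθσ : θ < σ := by linarith
  set P : ℝ := ∏ p ∈ ρ.primeFactors, (1 + (p : ℝ)⁻¹) with hP
  have hP1 : 1 ≤ P := one_le_prod_one_add_inv ρ
  -- the representation
  have hrep := mollLog_eq_integral hY0 hσ0 hθσ ρ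
  -- `Y^σ = e Y^θ`
  have hYσ : Y ^ σ = Real.exp 1 * Y ^ θ := by
    rw [hσ, Real.rpow_add hY0, hη, rpow_inv_log hY1, mul_comm]
  -- pointwise bound of the integrand by the majorant `M`
  set A : ℝ := Real.exp 1 / (2 * π) * Y ^ θ * Real.sqrt (2 * P) * Real.sqrt CK with hA
  set B : ℝ := Real.exp 1 / (2 * π) * Y ^ θ * Real.sqrt (2 * P) * Real.sqrt (3 / η) * 2 with hB
  have hA0 : 0 ≤ A := by positivity
  have hB0 : 0 ≤ B := by positivity
  set M : ℝ → ℝ := fun y ↦ A * (σ ^ 2 + y ^ 2) ^ (-(3 / 4 : ℝ)) + B * (1 + y ^ 2)⁻¹ with hM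
  have hbound : ∀ y : ℝ, ‖mollLogIntegrand θ Y σ ρ y‖ ≤ M y := by
    intro y
    set w : ℂ := 1 - θ + ((σ : ℂ) + y * I) with hw
    have hwre : w.re = 1 + η := by simp [hw, hσ]; ring
    have hwim : w.im = y := by simp [hw]
    have hw1 : 1 < w.re := by rw [hwre]; linarith
    have hL := norm_LSeries_alphaCop_le hρ hw1
    have hnorm : ‖mollLogIntegrand θ Y σ ρ y‖ =
        1 / (2 * π) * Y ^ σ * (1 / (σ ^ 2 + y ^ 2)) * ‖LSeries (fun n ↦ alphaCop ρ n) w‖ := by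
      rw [mollLogIntegrand, ← hw]
      simp only [norm_mul, norm_div, norm_one, norm_sq_ofReal_add_mul_I,
        Complex.norm_cpow_eq_rpow_re_of_pos hY0, Complex.norm_ofNat, Complex.norm_real, Real.norm_eq_abs,
        abs_of_pos Real.pi_pos, add_re, ofReal_re, mul_re, I_re, mul_zero, ofReal_im, I_im, mul_one,
        sub_self, add_zero]
    rw [hnorm, hYσ]
    have hden : 0 < σ ^ 2 + y ^ 2 := by positivity
    rcases le_or_gt |y| 1 with hy | hy
    · -- near the pole
      have hmem : w ∈ nearOneRect := by
        rw [nearOneRect, mem_reProdIm, hwre, hwim]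
        exact ⟨⟨by linarith, by linarith⟩, abs_le.mp hy⟩
      have hw1' : w ≠ 1 := fun h ↦ by rw [h] at hw1; simp at hw1
      have hz := hnear w hmem hw1'
      have hw1norm : ‖w - 1‖ = Real.sqrt (η ^ 2 + y ^ 2) := by
        rw [Complex.norm_def, Complex.normSq_apply]
        congr 1
        simp [hw, hσ]; ring
      have hsq : Real.sqrt ‖(riemannZeta w)⁻¹‖ ≤ Real.sqrt CK * (σ ^ 2 + y ^ 2) ^ (1 / 4 : ℝ) := by
        calc Real.sqrt ‖(riemannZeta w)⁻¹‖ ≤ Real.sqrt (CK * Real.sqrt (η ^ 2 + y ^ 2)) := by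
              rw [← hw1norm]; exact Real.sqrt_le_sqrt hz
          _ = Real.sqrt CK * (η ^ 2 + y ^ 2) ^ (1 / 4 : ℝ) := by
              rw [Real.sqrt_mul hCK.le, sqrt_sqrt_eq_rpow_quarter (by positivity)]
          _ ≤ Real.sqrt CK * (σ ^ 2 + y ^ 2) ^ (1 / 4 : ℝ) := by
              gcongr
              nlinarith
      have hmain : 1 / (2 * π) * (Real.exp 1 * Y ^ θ) * (1 / (σ ^ 2 + y ^ 2)) *
          ‖LSeries (fun n ↦ alphaCop ρ n) w‖ ≤ A * (σ ^ 2 + y ^ 2) ^ (-(3 / 4 : ℝ)) := by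
        have hpow : (1 / (σ ^ 2 + y ^ 2)) * (σ ^ 2 + y ^ 2) ^ (1 / 4 : ℝ) = (σ ^ 2 + y ^ 2) ^ (-(3 / 4 : ℝ)) := by
          rw [one_div, ← Real.rpow_neg_one, ← Real.rpow_add hden]; norm_num
        calc 1 / (2 * π) * (Real.exp 1 * Y ^ θ) * (1 / (σ ^ 2 + y ^ 2)) * ‖LSeries (fun n ↦ alphaCop ρ n) w‖
            ≤ 1 / (2 * π) * (Real.exp 1 * Y ^ θ) * (1 / (σ ^ 2 + y ^ 2)) *
                (Real.sqrt (2 * P) * (Real.sqrt CK * (σ ^ 2 + y ^ 2) ^ (1 / 4 : ℝ))) := by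
              gcongr
              exact hL.trans (mul_le_mul_of_nonneg_left hsq (Real.sqrt_nonneg _))
          _ = A * ((1 / (σ ^ 2 + y ^ 2)) * (σ ^ 2 + y ^ 2) ^ (1 / 4 : ℝ)) := by rw [hA]; ring
          _ = A * (σ ^ 2 + y ^ 2) ^ (-(3 / 4 : ℝ)) := by rw [hpow]
      calc _ ≤ A * (σ ^ 2 + y ^ 2) ^ (-(3 / 4 : ℝ)) := hmain
        _ ≤ M y := by rw [hM]; simp only; linarith [mul_nonneg hB0 (inv_nonneg.mpr (by positivity : (0:ℝ) ≤ 1 + y ^ 2))]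
    · -- far from the pole
      have hz : ‖(riemannZeta w)⁻¹‖ ≤ 3 / η := by
        have := norm_inv_zeta_le_far hη0 hη2 y
        have hw' : w = 1 + η + y * I := by
          rw [hw, hσ]; push_cast; ring
        rwa [hw']
      have hsq : Real.sqrt ‖(riemannZeta w)⁻¹‖ ≤ Real.sqrt (3 / η) := Real.sqrt_le_sqrt hz
      have hy2 : 1 ≤ y ^ 2 := by nlinarith [abs_nonneg y, sq_abs y]
      have hfrac : 1 / (σ ^ 2 + y ^ 2) ≤ 2 * (1 + y ^ 2)⁻¹ := by
        rw [div_le_iff₀ hden, mul_comm, ← div_eq_mul_inv, ← mul_div_assoc, le_div_iff₀ (by positivity)]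
        nlinarith [sq_nonneg σ]
      have hmain : 1 / (2 * π) * (Real.exp 1 * Y ^ θ) * (1 / (σ ^ 2 + y ^ 2)) *
          ‖LSeries (fun n ↦ alphaCop ρ n) w‖ ≤ B * (1 + y ^ 2)⁻¹ := by
        calc 1 / (2 * π) * (Real.exp 1 * Y ^ θ) * (1 / (σ ^ 2 + y ^ 2)) * ‖LSeries (fun n ↦ alphaCop ρ n) w‖
            ≤ 1 / (2 * π) * (Real.exp 1 * Y ^ θ) * (2 * (1 + y ^ 2)⁻¹) *
                (Real.sqrt (2 * P) * Real.sqrt (3 / η)) := by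
              gcongr
              exact hL.trans (mul_le_mul_of_nonneg_left hsq (Real.sqrt_nonneg _))
          _ = B * (1 + y ^ 2)⁻¹ := by rw [hB]; ring
      calc _ ≤ B * (1 + y ^ 2)⁻¹ := hmain
        _ ≤ M y := by
            rw [hM]; simp only
            linarith [mul_nonneg hA0 (Real.rpow_nonneg hden.le (-(3 / 4 : ℝ)))]
  -- integrate the majorant
  have hMint : Integrable M := by
    refine ((integrable_sq_add_sq_rpow hσ0).const_mul A).add (integrable_inv_one_add_sq.const_mul B)
  have hMval : ∫ y, M y = A * (C₀ * σ ^ (-(1 / 2 : ℝ))) + B * π := by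
    rw [hM]
    simp only
    rw [integral_add ((integrable_sq_add_sq_rpow hσ0).const_mul A) (integrable_inv_one_add_sq.const_mul B),
      integral_const_mul, integral_const_mul, integral_sq_add_sq_rpow hσ0, integral_univ_inv_one_add_sq]
  have hint : |mollLog θ Y ρ| ≤ ∫ y, M y := by
    have h1 : |mollLog θ Y ρ| = ‖((mollLog θ Y ρ : ℝ) : ℂ)‖ := by
      rw [Complex.norm_real, Real.norm_eq_abs]
    rw [h1, hrep]
    refine (norm_integral_le_integral_norm _).trans ?_
    exact integral_mono_of_nonneg (Eventually.of_forall fun y ↦ norm_nonneg _) hMint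
      (Eventually.of_forall hbound)
  -- final numerics: `σ^{-1/2} ≤ η^{-1/2} = (log Y)^{1/2}`, `(3/η)^{1/2} = √3 (log Y)^{1/2}`
  have hlogY : Real.log Y = 1 / η := by rw [hη, one_div_one_div]
  have hσpow : σ ^ (-(1 / 2 : ℝ)) ≤ Real.sqrt (Real.log Y) := by
    rw [hlogY, Real.sqrt_eq_rpow, Real.rpow_neg hσ0.le, one_div η, Real.inv_rpow hη0.le]
    exact inv_anti₀ (Real.rpow_pos_of_pos hη0 _) (Real.rpow_le_rpow hη0.le (by linarith) (by norm_num))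
  have h3η : Real.sqrt (3 / η) = Real.sqrt 3 * Real.sqrt (Real.log Y) := by
    rw [hlogY, ← Real.sqrt_mul (by norm_num : (0 : ℝ) ≤ 3)]; congr 1; ring
  have h2P : Real.sqrt (2 * P) = Real.sqrt 2 * Real.sqrt P := Real.sqrt_mul (by norm_num) P
  rw [hMval, hA, hB, h3η, h2P] at hint
  refine hint.trans ?_
  have hsl : 0 ≤ Real.sqrt (Real.log Y) := Real.sqrt_nonneg _
  have hkey : Real.exp 1 / (2 * π) * Y ^ θ * (Real.sqrt 2 * Real.sqrt P) * Real.sqrt CK *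
      (C₀ * σ ^ (-(1 / 2 : ℝ))) ≤
      Real.exp 1 / (2 * π) * Y ^ θ * (Real.sqrt 2 * Real.sqrt P) * Real.sqrt CK * (C₀ * Real.sqrt (Real.log Y)) := by
    gcongr
    · exact threeQuarterConst_nonneg
  have : Real.exp 1 / (2 * π) * Y ^ θ * (Real.sqrt 2 * Real.sqrt P) * Real.sqrt CK *
        (C₀ * Real.sqrt (Real.log Y)) +
      Real.exp 1 / (2 * π) * Y ^ θ * (Real.sqrt 2 * Real.sqrt P) * (Real.sqrt 3 * Real.sqrt (Real.log Y)) * 2 * π =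
      Real.exp 1 / (2 * π) * Real.sqrt 2 * (Real.sqrt CK * C₀ + 2 * π * Real.sqrt 3) * Y ^ θ *
        Real.sqrt (Real.log Y) * Real.sqrt P := by ring
  linarith

/-- **Titchmarsh's Lemma 10.12** (all `Y ≥ 1`): there is an absolute constant `C` with
`|∑_{1≤κ<Y,(κ,ρ)=1} α_κ κ^{θ-1} log(Y/κ)| ≤ C Y^θ (1 + log Y)^{1/2} (∏_{p∣ρ}(1+1/p))^{1/2}`
for all `ρ ≥ 1`, `θ ≥ 0`, `Y ≥ 1`. Titchmarsh states it for `0 ≤ θ ≤ ½` and `Y = X/d ≥ 2`,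
with `log^{1/2}(X/d)`; for `1 ≤ Y < 2` the sum is `log Y ≤ 1`. [cite: Titchmarsh1986, Lemma 10.12] -/
theorem abs_mollLog_le :
    ∃ C : ℝ, 0 < C ∧ ∀ ρ : ℕ, ρ ≠ 0 → ∀ θ : ℝ, 0 ≤ θ → ∀ Y : ℝ, 1 ≤ Y →
      |mollLog θ Y ρ| ≤ C * Y ^ θ * Real.sqrt (1 + Real.log Y) *
        Real.sqrt (∏ p ∈ ρ.primeFactors, (1 + (p : ℝ)⁻¹)) := by
  obtain ⟨C, hC, h⟩ := abs_mollLog_le_of_two_le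
  refine ⟨max C 1, by positivity, fun ρ hρ θ hθ Y hY ↦ ?_⟩
  have hP1 : 1 ≤ Real.sqrt (∏ p ∈ ρ.primeFactors, (1 + (p : ℝ)⁻¹)) :=
    Real.one_le_sqrt.mpr (one_le_prod_one_add_inv ρ)
  have hYθ : 1 ≤ Y ^ θ := Real.one_le_rpow hY hθ
  rcases le_or_gt 2 Y with h2 | h2
  · have hlog : 0 ≤ Real.log Y := Real.log_nonneg hY
    calc |mollLog θ Y ρ| ≤ C * Y ^ θ * Real.sqrt (Real.log Y) *
          Real.sqrt (∏ p ∈ ρ.primeFactors, (1 + (p : ℝ)⁻¹)) := h ρ hρ θ hθ Y h2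
      _ ≤ max C 1 * Y ^ θ * Real.sqrt (1 + Real.log Y) *
          Real.sqrt (∏ p ∈ ρ.primeFactors, (1 + (p : ℝ)⁻¹)) := by
          gcongr
          · exact le_max_left _ _
          · linarith
  · -- `1 ≤ Y < 2`: only `κ = 1` contributes
    have hrange : mollRange Y ⊆ {1} := by
      intro κ hκ
      obtain ⟨h1, hlt⟩ := mem_mollRange.mp hκ
      have : (κ : ℝ) < 2 := lt_trans hlt h2
      have : κ < 2 := by exact_mod_cast this
      rw [Finset.mem_singleton]; omega
    have hval : |mollLog θ Y ρ| ≤ Real.log Y := by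
      rw [mollLog]
      rcases Finset.subset_singleton_iff.mp hrange with h0 | h1
      · rw [h0, Finset.sum_empty, abs_zero]; exact Real.log_nonneg hY
      · rw [h1, Finset.sum_singleton]
        simp only [Nat.cast_one, Real.one_rpow, selbergAlpha_one, one_mul, div_one, Nat.coprime_one_left_iff,
          if_true]
        rw [abs_of_nonneg (Real.log_nonneg hY)]
    have hlog2 : Real.log Y ≤ 1 := by
      have := Real.log_le_sub_one_of_pos (by linarith : 0 < Y); linarith
    have hs : 1 ≤ Real.sqrt (1 + Real.log Y) := Real.one_le_sqrt.mpr (by linarith [Real.log_nonneg hY])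
    calc |mollLog θ Y ρ| ≤ 1 := hval.trans hlog2
      _ ≤ max C 1 * Y ^ θ * Real.sqrt (1 + Real.log Y) *
          Real.sqrt (∏ p ∈ ρ.primeFactors, (1 + (p : ℝ)⁻¹)) := by
          have h1 : (1 : ℝ) ≤ max C 1 := le_max_right _ _
          calc (1 : ℝ) = 1 * 1 * 1 * 1 := by ring
            _ ≤ _ := by gcongr

end Literature.NumberTheory.LFunctions.SelbergMollifier
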